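import Literature.NumberTheory.EllipticCurves.ModularFormsGamma0Rank
import Literature.NumberTheory.EllipticCurves.ModularFormsLevelFreeModule
import HarnessLib

/-!
# `M(Γ)` over `ℂ[E₄, E₆]` for a finite-index level `Γ ∋ T, -1`: rank `[SL₂(ℤ) : Γ]` from a rank
# input, the determinant `𝒟` of the basis-conjugate matrix, `𝒟¹² = cΔ^K`, and the generator
# weights modulo `4` and `6` (the level-general form of `ModularFormsGamma0Rank`)

`ModularFormsGamma0Rank` proved, for `Γ₀(N)`, that a level-one basis of `M(Γ₀(N))` has exactly
`μ = [SL₂(ℤ) : Γ₀(N)]` elements and satisfies Gannon's elliptic constraints, the level entering only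
through (i) the explicit `ℂ[E₄, E₆]`-independent forms `Δ^{μ-1-i}Δ_N^i` and the non-vanishing of
their conjugate determinant (a Vandermonde), and (ii) the fixed cosets of `S`, `TS` on `SL₂(ℤ)/Γ₀(N)`
(`ν₂`, `ν₃`). This file is the **level-general form** for `Γ ≤ SL₂(ℤ)` of finite index with
`T, -1 ∈ Γ` (sub-namespace `Level`, continuing `ModularFormsLevelFreeModule`), with (i) abstracted
into the hypothesis structure `Level.RankInput Γ` — `[SL₂(ℤ) : Γ]` forms `G_i ∈ M_{w₀}(Γ)` of a common
weight `w₀ ≥ 0` whose conjugate matrix `((G_i ∣ g_a⁻¹)(τ))_{a,i}` over the cosets `g_aΓ` is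
invertible at some `τ` — and (ii) kept symbolic as `Level.nu₂Level Γ = #{x ∈ SL₂(ℤ)/Γ : Sx = x}`,
`Level.nu₃Level Γ = #{x : (ST)x = x}`:

* `Level.cosetSlash`, covariance, `Level.RankInput`, `Level.RankInput.indep` (a rank input is
  `ℂ[E₄, E₆]`-independent: where the conjugate determinant is non-zero the relation slashed by the
  coset representatives forces the coefficients to vanish, and that locus is dense);
* `Level.IsLevelBasis.finrank_eq` (`dim M_m(Γ) = ∑ dim R_{m-k_i}`), `Level.IsLevelBasis.index_le`
  (**rank `≥ [SL₂(ℤ) : Γ]`** from a rank input), `Level.exists_isLevelBasis_card_eq` (**a level-one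
  basis indexed by `Fin [SL₂(ℤ) : Γ]`**, even weights `≥ 0`);
* `Level.serreDerivative_mem` (the Serre derivative preserves `M_k(Γ)`; the translates `f ∣ g` are
  periodic of some period `w ≤ [SL₂(ℤ):Γ]`, `Level.exists_slash_slash_T_pow`), the basis-conjugate
  matrix `Level.basisMatrix`, `Level.basisDet = 𝒟`, `Level.totalWeight = K`,
  `Level.normalizedDeriv_basisDet` (`D𝒟 = (K/12)E₂𝒟`), `Level.exists_basisDet_pow_eq`
  (`𝒟¹² = cΔ^K`), `Level.exists_basisDet_ne_zero` (from the rank input), `Level.basisDet_ne_zero`,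
  `Level.tendsto_norm_basisDet_pow`;
* `Level.two_mul_card_four_dvd`, `Level.three_mul_card_six_dvd` — **Gannon's Thm. 3.4(b)**:
  `2#{4 ∣ k_j} = [SL₂(ℤ):Γ] + ν₂(Γ)`, `3#{6 ∣ k_j} = [SL₂(ℤ):Γ] + 2ν₃(Γ)`,
  `3#{k_j ≡ 2 (6)} + ν₃(Γ) = [SL₂(ℤ):Γ] = 3#{k_j ≡ 4 (6)} + ν₃(Γ)`.

For `Γ = ±Γ₁(N)` (`ModularFormsGamma1PlusMinus`: `ν₂ = ν₃ = 0` for `N ≥ 4`) the rank input is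
supplied from `ModularFormsGamma1ExplicitForms` in a sequel, and the cusp count `∑ k_j` follows the
`Γ₀(N)` model `ModularFormsGamma0Genus`. All proofs are those of the `Γ₀(N)` file; no named facts.

## References

* T. Gannon, *The theory of vector-valued modular forms for the modular group*, Contrib. Math.
  Comput. Sci. 8, Springer (2014), 247–286, Thm. 3.4 and its proof, §3.5.
* C. Marks, G. Mason, *Structure of the module of vector-valued modular forms*, J. London Math.
  Soc. (2) 82 (2010), 32–48, Thm. 1 and §3.
-/

noncomputable section

open UpperHalfPlane hiding I
open ModularForm Complex Matrix.SpecialLinearGroup Filter Asymptotics CongruenceSubgroup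
open EisensteinSeries ModularGroup
open scoped MatrixGroups Real ModularForm Topology Manifold

namespace Literature.NumberTheory.EllipticCurves.ModularForms

namespace Level

/-! ### Conjugates of `Γ`-forms over `SL₂(ℤ)/Γ` -/

section CosetSlash

variable (Γ : Subgroup SL(2, ℤ))

/-- The translate `F ∣ₖ g⁻¹` attached to a coset `x = gΓ` (via the chosen representative
`x.out`; independent of the representative for `Γ`-invariant `F`, `cosetSlash_mk`). [folklore] -/
def cosetSlash (k : ℤ) (F : ℍ → ℂ) (x : SL(2, ℤ) ⧸ Γ) : ℍ → ℂ :=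
  F ∣[k] ((x.out⁻¹ : SL(2, ℤ)) : GL (Fin 2) ℝ)

variable {Γ}

/-- `cosetSlash` on `⟦g⟧` is `F ∣ g⁻¹` for `Γ`-invariant `F`. [folklore] -/
theorem cosetSlash_mk {k : ℤ} {F : ℍ → ℂ} (hF : ∀ γ ∈ Γ, F ∣[k] (γ : GL (Fin 2) ℝ) = F)
    (g : SL(2, ℤ)) :
    cosetSlash Γ k F (g : SL(2, ℤ) ⧸ Γ) = F ∣[k] ((g⁻¹ : SL(2, ℤ)) : GL (Fin 2) ℝ) := by
  obtain ⟨γ₀, hγ₀⟩ := QuotientGroup.mk_out_eq_mul (Γ) g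
  unfold cosetSlash
  rw [hγ₀, mul_inv_rev, coeGL_mul, SlashAction.slash_mul, hF _ (inv_mem γ₀.2)]

/-- Invariance in the form needed: members of `A_k` are `Γ`-invariant. [folklore] -/
theorem slash_eq_of_mem_levelSpace {k : ℤ} {F : ℍ → ℂ} (hF : F ∈ levelSpace Γ k) :
    ∀ γ ∈ Γ, F ∣[k] (γ : GL (Fin 2) ℝ) = F :=
  fun γ hγ ↦ slash_eq_of_mem_formSpace hF ⟨γ, hγ, rfl⟩

/-- **Covariance**: `(cosetSlash x) ∣ h = cosetSlash (h⁻¹ · x)` for `h ∈ SL₂(ℤ)`. [folklore] -/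
theorem cosetSlash_slash {k : ℤ} {F : ℍ → ℂ} (hF : ∀ γ ∈ Γ, F ∣[k] (γ : GL (Fin 2) ℝ) = F)
    (x : SL(2, ℤ) ⧸ Γ) (h : SL(2, ℤ)) :
    cosetSlash Γ k F x ∣[k] (h : GL (Fin 2) ℝ) = cosetSlash Γ k F (h⁻¹ • x) := by
  induction x using QuotientGroup.induction_on with
  | H g =>
    rw [cosetSlash_mk hF, show h⁻¹ • (g : SL(2, ℤ) ⧸ Γ) = ((h⁻¹ * g : SL(2, ℤ)) : SL(2, ℤ) ⧸ Γ)
      from rfl, cosetSlash_mk hF, ← SlashAction.slash_mul, ← coeGL_mul, mul_inv_rev, inv_inv]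

/-- `cosetSlash` of a member of `A_k` is holomorphic. [folklore] -/
theorem mdifferentiable_cosetSlash {k : ℤ} {F : ℍ → ℂ} (hF : F ∈ levelSpace Γ k)
    (x : SL(2, ℤ) ⧸ Γ) : MDiff (cosetSlash Γ k F x) :=
  (mdifferentiable_of_mem_formSpace hF).slash _ _

variable [Γ.FiniteIndex]

/-- `cosetSlash` of a member of `A_k` is bounded at `i∞`. [folklore] -/
theorem isBoundedAtImInfty_cosetSlash {k : ℤ} {F : ℍ → ℂ} (hF : F ∈ levelSpace Γ k)
    (x : SL(2, ℤ) ⧸ Γ) : IsBoundedAtImInfty (cosetSlash Γ k F x) :=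
  isBoundedAtImInfty_slash_of_mem_formSpace hF _

omit [Γ.FiniteIndex] in
/-- `(-1) · x = x` on `SL₂(ℤ)/Γ` when `-1 ∈ Γ` (`-1` is central). [folklore] -/
theorem neg_one_smul_coset (hneg : -1 ∈ Γ) (q : SL(2, ℤ) ⧸ Γ) : (-1 : SL(2, ℤ)) • q = q := by
  induction q using QuotientGroup.induction_on with
  | H g =>
    rw [MulAction.Quotient.smul_mk, smul_eq_mul, QuotientGroup.eq]
    have : (-1 * g)⁻¹ * g = -1 := by simp
    rw [this]
    exact hneg

end CosetSlash

/-! ### The coset enumeration, rank inputs, and `rank ≥ [SL₂(ℤ) : Γ]` -/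

section Rank

variable (Γ : Subgroup SL(2, ℤ)) [Γ.FiniteIndex]

/-- The finite coset space `SL₂(ℤ)/Γ` as a `Fintype` (local, from `Finite`). [folklore] -/
local instance : Fintype (SL(2, ℤ) ⧸ Γ) := Fintype.ofFinite _

/-- `#(SL₂(ℤ)/Γ) = [SL₂(ℤ) : Γ]`. [folklore] -/
theorem card_quotient_eq : Fintype.card (SL(2, ℤ) ⧸ Γ) = Γ.index := by
  rw [← Nat.card_eq_fintype_card, Subgroup.index]

/-- The enumeration `SL₂(ℤ)/Γ ≃ Fin [SL₂(ℤ) : Γ]`. [folklore] -/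
def cosetEquiv : (SL(2, ℤ) ⧸ Γ) ≃ Fin Γ.index :=
  Fintype.equivFinOfCardEq (card_quotient_eq Γ)

/-- **A rank input for the level `Γ`**: `[SL₂(ℤ) : Γ]` forms `G_i ∈ M_{w₀}(Γ)` of a common weight
`w₀ ≥ 0` whose conjugate matrix `((G_i ∣ g_a⁻¹)(τ))_{a,i}` over the cosets `g_aΓ` (enumerated by
`cosetEquiv`) is invertible at some point `τ` — the level-specific input of the free-module route
(for `Γ₀(N)`: `Δ^{μ-1-i}Δ_N^i` with a Vandermonde determinant; for `±Γ₁(N)`: the blocks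
`E_4^χ Δ^{μ-1-i}Δ_N^i`). [cite: Gannon2014, Thm. 3.4(a)] -/
structure RankInput where
  /-- The common weight of the forms. -/
  wt₀ : ℤ
  /-- The forms. -/
  G : Fin Γ.index → ℍ → ℂ
  /-- The weight is non-negative. -/
  wt₀_nonneg : 0 ≤ wt₀
  /-- The forms are modular of level `Γ` and weight `w₀`. -/
  mem : ∀ i, G i ∈ levelSpace Γ wt₀
  /-- The conjugate matrix is invertible somewhere. -/
  det_ne_zero : ∃ τ : ℍ,
    (Matrix.of fun a i : Fin Γ.index ↦ cosetSlash Γ wt₀ (G i) ((cosetEquiv Γ).symm a) τ).det ≠ 0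

variable {Γ}

/-- The conjugate matrix of a rank input, as a function of `τ`. [folklore] -/
def RankInput.conjMatrix (R : RankInput Γ) (τ : ℍ) : Matrix (Fin Γ.index) (Fin Γ.index) ℂ :=
  Matrix.of fun a i ↦ cosetSlash Γ R.wt₀ (R.G i) ((cosetEquiv Γ).symm a) τ

/-- The conjugate determinant of a rank input is holomorphic. [folklore] -/
theorem RankInput.mdifferentiable_det (R : RankInput Γ) : MDiff (fun τ ↦ (R.conjMatrix τ).det) := by
  have : (fun τ ↦ (R.conjMatrix τ).det) = ∑ σ : Equiv.Perm (Fin Γ.index),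
      (fun _ ↦ ((Equiv.Perm.sign σ : ℤ) : ℂ)) * ∏ i, (fun τ ↦ R.conjMatrix τ (σ i) i) := by
    funext τ
    rw [Matrix.det_apply']
    simp only [Finset.sum_apply, Pi.mul_apply, Finset.prod_apply]
  rw [this]
  exact mdifferentiable_finset_sum _ fun σ _ ↦ mdifferentiable_const.mul
    (mdifferentiable_finset_prod _ fun i _ ↦ mdifferentiable_cosetSlash (R.mem i) _)

/-- **A rank input is `ℂ[E₄, E₆]`-independent**: a relation `∑ p_i G_i = 0` with level-one `p_i`
of a common weight `w` is trivial. (Slashing by `g_a⁻¹` gives `∑_i p_i (G_i ∣ g_a⁻¹) = 0`, i.e.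
`conjMatrix(τ) · p(τ) = 0`; where the determinant is non-zero, `p(τ) = 0`, and that holomorphic
determinant is `≢ 0`, so `det · p_i = 0` forces `p_i = 0` by the identity theorem.) [folklore] -/
theorem RankInput.indep (R : RankInput Γ) (w : ℤ) (p : Fin Γ.index → ℍ → ℂ)
    (hp : ∀ i, p i ∈ levelOneSpace w) (h0 : ∑ i, p i * R.G i = 0) : ∀ i, p i = 0 := by
  classical
  have hG := fun i ↦ slash_eq_of_mem_levelSpace (R.mem i)
  -- the slashed relations
  have hrel : ∀ (a : Fin Γ.index) (τ : ℍ), ∑ i, R.conjMatrix τ a i * p i τ = 0 := by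
    intro a τ
    set g : SL(2, ℤ) := ((cosetEquiv Γ).symm a).out with hg
    have h1 := congrArg (fun f : ℍ → ℂ ↦ (f ∣[w + R.wt₀] ((g⁻¹ : SL(2, ℤ)) : GL (Fin 2) ℝ)) τ) h0
    simp only [SlashAction.zero_slash, Pi.zero_apply] at h1
    rw [← h1, sum_mul_slash_of_levelOne _ (fun i _ ↦ by rw [add_sub_cancel_right]; exact hp i),
      Finset.sum_apply]
    refine Finset.sum_congr rfl fun i _ ↦ ?_
    rw [Pi.mul_apply, mul_comm]
    rfl
  -- where the determinant is non-zero, the coefficients vanish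
  have hpt : ∀ τ, (R.conjMatrix τ).det ≠ 0 → ∀ i, p i τ = 0 := by
    intro τ hτ i
    have hv : (R.conjMatrix τ).mulVec (fun i ↦ p i τ) = 0 := by
      funext a
      exact hrel a τ
    exact congrFun (Matrix.eq_zero_of_mulVec_eq_zero hτ hv) i
  -- the determinant is `≢ 0`
  have hdet0 : (fun τ ↦ (R.conjMatrix τ).det) ≠ 0 := by
    obtain ⟨τ, hτ⟩ := R.det_ne_zero
    intro h
    exact hτ (congrFun h τ)
  intro i
  have hprod : (fun τ ↦ (R.conjMatrix τ).det) * p i = 0 := by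
    funext τ
    by_cases hτ : (R.conjMatrix τ).det = 0
    · simp [hτ]
    · simp [hpt τ hτ i]
  exact eq_zero_of_mul_eq_zero_of_mdifferentiable R.mdifferentiable_det hdet0
    (mdifferentiable_of_mem_formSpace (hp i)).continuous hprod

variable [hT : Fact (ModularGroup.T ∈ Γ)]


omit hT in
/-- **Dimension of `A_m` from a level-one basis**: `dim A_m = ∑_i dim R_{m - k_i}`. [folklore] -/
theorem IsLevelBasis.finrank_eq {r : ℕ} {wt : Fin r → ℤ} {F : Fin r → ℍ → ℂ}
    (hb : IsLevelBasis Γ wt F) (m : ℤ) :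
    Module.finrank ℂ (levelSpace Γ m) = ∑ i, Module.finrank ℂ (levelOneSpace (m - wt i)) := by
  let Ψ : (Π i, levelOneSpace (m - wt i)) →ₗ[ℂ] (ℍ → ℂ) :=
    { toFun := fun p ↦ ∑ i : Fin r, ((p i : ℍ → ℂ) * F i : ℍ → ℂ)
      map_add' := fun p p' ↦ by
        simp only [Pi.add_apply, Submodule.coe_add, add_mul, Finset.sum_add_distrib]
      map_smul' := fun c p ↦ by
        simp only [Pi.smul_apply, Submodule.coe_smul, RingHom.id_apply, Finset.smul_sum, smul_mul_assoc] }
  have hmem : ∀ p, Ψ p ∈ levelSpace Γ m := fun p ↦ by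
    show (∑ i : Fin r, ((p i : ℍ → ℂ) * F i : ℍ → ℂ)) ∈ levelSpace Γ m
    refine Submodule.sum_mem _ fun i _ ↦ ?_
    have := levelOne_mul_mem Γ (p i).2 (hb.mem i)
    rwa [sub_add_cancel] at this
  have hinj : Function.Injective (Ψ.codRestrict _ hmem) := by
    rw [injective_iff_map_eq_zero]
    intro p hp0
    have hsum0 : ∑ i : Fin r, ((p i : ℍ → ℂ) * F i : ℍ → ℂ) = 0 := congrArg Subtype.val hp0
    have := hb.indep m (fun i ↦ p i) (fun i ↦ (p i).2) hsum0
    funext i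
    exact Subtype.ext (this i)
  have hsurj : Function.Surjective (Ψ.codRestrict _ hmem) := by
    rintro ⟨f, hf⟩
    obtain ⟨p, hp, hfp⟩ := hb.span m f hf
    exact ⟨fun i ↦ ⟨p i, hp i⟩, Subtype.ext hfp.symm⟩
  rw [← (LinearEquiv.ofBijective _ ⟨hinj, hsurj⟩).finrank_eq, Module.finrank_pi_fintype]

variable (Γ)

/-- **The rank is at least `[SL₂(ℤ) : Γ]`** given a rank input: the `[SL₂(ℤ):Γ]` independent forms
`G_i` give `dim A_{12L+w₀} ≥ [SL₂(ℤ):Γ]·L`, while `r` generators give `≤ r(L + w₀/12 + 1)`.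
[cite: Gannon2014, Thm. 3.4] -/
theorem IsLevelBasis.index_le {r : ℕ} {wt : Fin r → ℤ} {F : Fin r → ℍ → ℂ}
    (hb : IsLevelBasis Γ wt F) (R : RankInput Γ) : Γ.index ≤ r := by
  set μ := Γ.index with hμ
  set c : ℕ := R.wt₀.toNat / 12 + 1 with hc
  -- for every `L`: `μ L ≤ r (L + c)`
  have key : ∀ L : ℕ, μ * L ≤ r * (L + c) := by
    intro L
    set m : ℤ := 12 * L + R.wt₀ with hm
    -- lower bound from the rank input
    let Φ : (Fin μ → levelOneSpace (12 * (L : ℤ))) →ₗ[ℂ] (ℍ → ℂ) :=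
      { toFun := fun p ↦ ∑ i : Fin μ, ((p i : ℍ → ℂ) * R.G i : ℍ → ℂ)
        map_add' := fun p p' ↦ by
          simp only [Pi.add_apply, Submodule.coe_add, add_mul, Finset.sum_add_distrib]
        map_smul' := fun c p ↦ by
          simp only [Pi.smul_apply, Submodule.coe_smul, RingHom.id_apply, Finset.smul_sum, smul_mul_assoc] }
    have hΦmem : ∀ p, Φ p ∈ levelSpace Γ m := fun p ↦ by
      show (∑ i : Fin μ, ((p i : ℍ → ℂ) * R.G i : ℍ → ℂ)) ∈ levelSpace Γ m
      refine Submodule.sum_mem _ fun i _ ↦ ?_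
      exact levelOne_mul_mem Γ (p i).2 (R.mem i)
    have hΦinj : Function.Injective (Φ.codRestrict _ hΦmem) := by
      rw [injective_iff_map_eq_zero]
      intro p hp0
      have hsum0 : ∑ i : Fin μ, ((p i : ℍ → ℂ) * R.G i : ℍ → ℂ) = 0 :=
        congrArg Subtype.val hp0
      have := R.indep (12 * (L : ℤ)) (fun i ↦ p i) (fun i ↦ (p i).2) hsum0
      funext i
      exact Subtype.ext (this i)
    have hlow : μ * L ≤ Module.finrank ℂ (levelSpace Γ m) := by
      refine le_trans ?_ (LinearMap.finrank_le_finrank_of_injective hΦinj)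
      rw [Module.finrank_pi_fintype, Finset.sum_const, Finset.card_univ, Fintype.card_fin, smul_eq_mul]
      refine Nat.mul_le_mul_left μ ?_
      have := le_finrank_levelOneSpace (w := 12 * L) ⟨6 * L, by ring⟩
      rw [show ((12 * L : ℕ) : ℤ) = 12 * (L : ℤ) by push_cast; ring] at this
      omega
    -- upper bound from the basis
    have hup : Module.finrank ℂ (levelSpace Γ m) ≤ r * (L + c) := by
      rw [hb.finrank_eq m]
      refine le_trans (Finset.sum_le_sum fun i _ ↦ finrank_levelOneSpace_le (m - wt i)) ?_
      refine le_trans (Finset.sum_le_sum (g := fun _ ↦ L + c) fun i _ ↦ ?_) ?_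
      · have hwt0 : 0 ≤ wt i := by
          have h0 := hb.mem i
          by_contra hneg
          push Not at hneg
          have : levelSpace Γ (wt i) = ⊥ := formSpace_eq_bot_of_neg hneg
          rw [this, Submodule.mem_bot] at h0
          have := hb.indep (wt i) (fun j ↦ if j = i then 1 else 0) (fun j ↦ by
            split_ifs with hj
            · subst hj; rw [sub_self]; exact ⟨1, ModularForm.one_coe_eq_one⟩
            · exact Submodule.zero_mem _) (by simp [h0]) i
          simp at this
        have h1 : (m - wt i).toNat ≤ 12 * L + R.wt₀.toNat := by
          have := R.wt₀_nonneg
          rw [hm]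
          omega
        have h2 : (12 * L + R.wt₀.toNat) / 12 + 1 ≤ L + c := by
          rw [hc]
          omega
        exact le_trans (Nat.add_le_add_right (Nat.div_le_div_right h1) 1) h2
      · simp
    exact hlow.trans hup
  by_contra hlt
  push Not at hlt
  have h1 := key (r * c + 1)
  have h2 : r + 1 ≤ μ := hlt
  have h3 : (r + 1) * (r * c + 1) ≤ μ * (r * c + 1) := Nat.mul_le_mul_right _ h2
  have h4 : (r + 1) * (r * c + 1) ≤ r * (r * c + 1 + c) := h3.trans h1
  nlinarith

/-- **`rank = [SL₂(ℤ) : Γ]`**: with `r ≤ [SL₂(ℤ):Γ]` of `exists_isLevelBasis`, a rank input yields a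
level-one basis of `M(Γ)` indexed by `Fin [SL₂(ℤ) : Γ]`, of even weights `≥ 0`.
[cite: Gannon2014, Thm. 3.4] -/
theorem exists_isLevelBasis_card_eq (hneg : -1 ∈ Γ) (R : RankInput Γ) :
    ∃ (wt : Fin Γ.index → ℤ) (F : Fin Γ.index → ℍ → ℂ),
      IsLevelBasis Γ wt F ∧ ∀ i, 0 ≤ wt i ∧ Even (wt i) := by
  obtain ⟨r, wt, F, hb, hle, hwt⟩ := exists_isLevelBasis Γ hneg
  have hr : r = Γ.index := le_antisymm hle (IsLevelBasis.index_le Γ hb R)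
  subst hr
  exact ⟨wt, F, hb, hwt⟩

end Rank

/-! ### The Serre derivative preserves `M_k(Γ)` -/

section Serre

open Derivative

variable (Γ : Subgroup SL(2, ℤ)) [Γ.FiniteIndex]

/-- **A `Γ`-invariant function translated by `g ∈ SL₂(ℤ)` is invariant under some `T^w`,
`0 < w ≤ [SL₂(ℤ) : Γ]`** (`(gTg⁻¹)^w ∈ Γ` for some such `w`, by finiteness of the index, Mathlib
`Subgroup.exists_pow_mem_of_index_ne_zero`). [folklore] -/
theorem exists_slash_slash_T_pow {G : ℍ → ℂ} {k : ℤ}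
    (hG : ∀ γ ∈ Γ, G ∣[k] (γ : GL (Fin 2) ℝ) = G) (g : SL(2, ℤ)) :
    ∃ w : ℕ, 0 < w ∧ (G ∣[k] (g : GL (Fin 2) ℝ)) ∣[k] ((ModularGroup.T ^ (w : ℤ) : SL(2, ℤ)) : GL (Fin 2) ℝ) =
      G ∣[k] (g : GL (Fin 2) ℝ) := by
  obtain ⟨w, hw, -, hmem⟩ := Subgroup.exists_pow_mem_of_index_ne_zero
    (Subgroup.index_ne_zero_of_finite (H := Γ)) (g * ModularGroup.T * g⁻¹)
  refine ⟨w, hw, ?_⟩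
  have hconj : (g * ModularGroup.T * g⁻¹) ^ w = g * ModularGroup.T ^ (w : ℤ) * g⁻¹ := by
    rw [zpow_natCast, conj_pow]
  rw [hconj] at hmem
  rw [← SlashAction.slash_mul, ← coeGL_mul,
    show g * ModularGroup.T ^ (w : ℤ) = (g * ModularGroup.T ^ (w : ℤ) * g⁻¹) * g by group,
    coeGL_mul, SlashAction.slash_mul, hG _ hmem]

/-- **Periodicity of the translates of members of `A_k`**: `(G ∣ g) ∘ ofComplex` is `w`-periodic for
some `0 < w ≤ [SL₂(ℤ) : Γ]`. [folklore] -/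
theorem exists_periodic_slash_of_mem {k : ℤ} {G : ℍ → ℂ} (hG : G ∈ levelSpace Γ k) (g : SL(2, ℤ)) :
    ∃ w : ℕ, 0 < w ∧ Function.Periodic ((G ∣[k] (g : GL (Fin 2) ℝ)) ∘ ofComplex) (w : ℤ) := by
  obtain ⟨w, hw, h⟩ := exists_slash_slash_T_pow Γ (slash_eq_of_mem_levelSpace hG) g
  exact ⟨w, hw, periodic_comp_ofComplex_of_slash_T_zpow h⟩

/-- **The Serre derivative preserves `M_k(Γ)`**: `ϑ_k f = D f - (k/12)E₂ f ∈ M_{k+2}(Γ)` for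
`f ∈ M_k(Γ)` (equivariance is Mathlib's `serreDerivative_slash_equivariant`; at each cusp,
`ϑ(f ∣ g) = D(f ∣ g) - (k/12)E₂·(f ∣ g)` is bounded because `D` of a bounded holomorphic periodic
function tends to `0`, `ModularFormsRamanujan.isZeroAtImInfty_normalizedDeriv`). [folklore] -/
theorem serreDerivative_mem {k : ℤ} {f : ℍ → ℂ} (hf : f ∈ levelSpace Γ k) :
    serreDerivative k f ∈ levelSpace Γ (k + 2) := by
  have hhol := mdifferentiable_of_mem_formSpace hf
  have hinv := slash_eq_of_mem_levelSpace hf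
  rw [mem_formSpace_iff]
  refine ⟨serreDerivative_mdifferentiable _ hhol, ?_, fun g ↦ ?_⟩
  · rintro _ ⟨γ, hγ, rfl⟩
    have := serreDerivative_slash_invariant (k := k) hhol (γ := γ) (hinv γ hγ)
    rw [ModularForm.SL_slash] at this
    exact this
  · have heq := serreDerivative_slash_equivariant (k := k) hhol (γ := g)
    rw [ModularForm.SL_slash, ModularForm.SL_slash] at heq
    rw [heq]
    set G := f ∣[k] (g : GL (Fin 2) ℝ) with hGdef
    have hGhol : MDiff G := hhol.slash _ _
    have hGbdd : IsBoundedAtImInfty G := isBoundedAtImInfty_slash_of_mem_formSpace hf g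
    obtain ⟨w, hw, hper⟩ := exists_periodic_slash_of_mem Γ hf g
    have hD : IsBoundedAtImInfty (D G) :=
      (isZeroAtImInfty_normalizedDeriv (h := (w : ℤ)) (by exact_mod_cast hw)
        (by exact_mod_cast hper) hGhol hGbdd).boundedAtFilter
    have h2 : IsBoundedAtImInfty (fun τ ↦ (k : ℂ) * 12⁻¹ * E2 τ * G τ) := by
      have := (isBoundedAtImInfty_E2.mul hGbdd).const_mul_left ((k : ℂ) * 12⁻¹)
      refine this.congr_left fun τ ↦ ?_
      simp only [Pi.mul_apply]
      ring
    have hs : serreDerivative k G = fun z ↦ D G z - k * 12⁻¹ * E2 z * G z := rfl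
    rw [hs]
    exact hD.sub h2

end Serre

/-! ### The basis-conjugate matrix `Φ`, its determinant `𝒟`, and `ϑ 𝒟 = 0` -/

section Determinant

open Derivative

variable (Γ : Subgroup SL(2, ℤ)) [Γ.FiniteIndex]

variable (wt : Fin (Γ.index) → ℤ) (F : Fin (Γ.index) → ℍ → ℂ)

/-- The **basis-conjugate matrix** `Φ(τ)_{a,j} = (F_j ∣ g_a⁻¹)(τ)` over the cosets `g_aΓ`
and the generators `F_j` (Gannon's fundamental matrix `Ξ` for `ρ = Ind 1`). [cite: Gannon2014, Thm. 3.4] -/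
def basisMatrix (τ : ℍ) : Matrix (Fin (Γ.index)) (Fin (Γ.index)) ℂ :=
  fun a j ↦ cosetSlash Γ (wt j) (F j) ((cosetEquiv Γ).symm a) τ

/-- The determinant `𝒟(τ) = det Φ(τ)`. [cite: Gannon2014, Thm. 3.4] -/
def basisDet (τ : ℍ) : ℂ := (basisMatrix Γ wt F τ).det

/-- The total weight `K = ∑ k_j`. [folklore] -/
def totalWeight : ℤ := ∑ j, wt j

variable {Γ wt F}

/-- Entries of `Φ` are holomorphic. [folklore] -/
theorem mdifferentiable_basisMatrix (hb : IsLevelBasis Γ wt F) (a j : Fin (Γ.index)) :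
    MDiff (fun τ ↦ basisMatrix Γ wt F τ a j) :=
  mdifferentiable_cosetSlash (hb.mem j) _

/-- `𝒟` is holomorphic. [folklore] -/
theorem mdifferentiable_basisDet (hb : IsLevelBasis Γ wt F) : MDiff (basisDet Γ wt F) := by
  have : basisDet Γ wt F = ∑ σ : Equiv.Perm (Fin (Γ.index)),
      (fun _ ↦ ((Equiv.Perm.sign σ : ℤ) : ℂ)) * ∏ i, (fun τ ↦ basisMatrix Γ wt F τ (σ i) i) := by
    funext τ
    rw [basisDet, Matrix.det_apply']
    simp only [Finset.sum_apply, Pi.mul_apply, Finset.prod_apply]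
  rw [this]
  exact mdifferentiable_finset_sum _ fun σ _ ↦ mdifferentiable_const.mul
    (mdifferentiable_finset_prod _ fun i _ ↦ mdifferentiable_basisMatrix hb _ _)

/-- **The connection matrix**: `ϑ_{k_j} F_j = ∑_l P_{lj} F_l` with level-one `P_{lj} ∈ R_{k_j+2-k_l}`;
in particular `P_{jj} ∈ R₂ = 0`. [cite: Gannon2014, Thm. 3.3(b)] -/
theorem exists_connection (hb : IsLevelBasis Γ wt F) :
    ∃ P : Fin (Γ.index) → Fin (Γ.index) → ℍ → ℂ,
      (∀ l j, P l j ∈ levelOneSpace (wt j + 2 - wt l)) ∧ (∀ j, P j j = 0) ∧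
      ∀ j, serreDerivative (wt j) (F j) = ∑ l, P l j * F l := by
  have h := fun j ↦ hb.span (wt j + 2) _ (serreDerivative_mem Γ (hb.mem j))
  choose p hp hsum using h
  refine ⟨fun l j ↦ p j l, fun l j ↦ hp j l, fun j ↦ ?_, fun j ↦ hsum j⟩
  have := hp j j
  rw [show wt j + 2 - wt j = 2 by ring] at this
  obtain ⟨Q, hQ⟩ := this
  show p j j = 0
  rw [← hQ, rank_zero_iff_forall_zero.mp ModularForm.levelOne_weight_two_rank_zero Q]
  rfl

/-- **The derivative of the entries of `Φ`**: `D Φ_{a,j} = ∑_l P_{lj} Φ_{a,l} + (k_j/12) E₂ Φ_{a,j}`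
(Serre derivative equivariance under `g_a⁻¹`, level-one invariance of `P`). [folklore] -/
theorem normalizedDeriv_basisMatrix (hb : IsLevelBasis Γ wt F)
    {P : Fin (Γ.index) → Fin (Γ.index) → ℍ → ℂ}
    (hP : ∀ l j, P l j ∈ levelOneSpace (wt j + 2 - wt l))
    (hPF : ∀ j, serreDerivative (wt j) (F j) = ∑ l, P l j * F l) (a j : Fin (Γ.index)) (τ : ℍ) :
    D (fun τ ↦ basisMatrix Γ wt F τ a j) τ =
      ∑ l, P l j τ * basisMatrix Γ wt F τ a l + (wt j : ℂ) * 12⁻¹ * E2 τ * basisMatrix Γ wt F τ a j := by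
  set x := (cosetEquiv Γ).symm a with hx
  set g : SL(2, ℤ) := x.out with hg
  have hFj := mdifferentiable_of_mem_formSpace (hb.mem j)
  -- the entry as a slash
  have hentry : ∀ l, (fun τ ↦ basisMatrix Γ wt F τ a l) = F l ∣[wt l] ((g⁻¹ : SL(2, ℤ)) : GL (Fin 2) ℝ) := by
    intro l
    rfl
  rw [hentry j]
  -- `D (F ∣ g⁻¹) = ϑ (F ∣ g⁻¹) + (k/12) E₂ (F ∣ g⁻¹)` and `ϑ (F ∣ g⁻¹) = (ϑ F) ∣ g⁻¹`
  have h1 : D (F j ∣[wt j] ((g⁻¹ : SL(2, ℤ)) : GL (Fin 2) ℝ)) τ =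
      serreDerivative (wt j) (F j ∣[wt j] ((g⁻¹ : SL(2, ℤ)) : GL (Fin 2) ℝ)) τ +
        (wt j : ℂ) * 12⁻¹ * E2 τ * (F j ∣[wt j] ((g⁻¹ : SL(2, ℤ)) : GL (Fin 2) ℝ)) τ := by
    rw [serreDerivative_apply]
    ring
  have h2 : serreDerivative (wt j) (F j ∣[wt j] ((g⁻¹ : SL(2, ℤ)) : GL (Fin 2) ℝ)) =
      (∑ l, P l j * F l) ∣[wt j + 2] ((g⁻¹ : SL(2, ℤ)) : GL (Fin 2) ℝ) := by
    have := serreDerivative_slash_equivariant (k := wt j) hFj (γ := g⁻¹)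
    rw [ModularForm.SL_slash, ModularForm.SL_slash] at this
    rw [← this, hPF j]
  rw [h1, h2, SlashAction.sum_slash, Finset.sum_apply]
  congr 1
  refine Finset.sum_congr rfl fun l _ ↦ ?_
  rw [show wt j + 2 = (wt j + 2 - wt l) + wt l by ring, ← ModularForm.SL_slash,
    ModularForm.mul_slash_SL2]
  have hPl : P l j ∣[wt j + 2 - wt l] (g⁻¹ : SL(2, ℤ)) = P l j := by
    obtain ⟨Q, hQ⟩ := hP l j
    rw [← hQ, ModularForm.SL_slash]
    exact Q.slash_action_eq' _ ⟨g⁻¹, rfl⟩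
  rw [hPl]
  rfl

/-- **`ϑ_K 𝒟 = 0`**, i.e. `D 𝒟 = (K/12) E₂ 𝒟`: by the derivative of a determinant column by column,
each column derivative is `∑_l P_{lj}·(column l) + (k_j/12)E₂·(column j)`, contributing
`(P_{jj} + k_jE₂/12) 𝒟 = (k_j/12)E₂𝒟` (`P_{jj} ∈ M₂(SL₂(ℤ)) = 0`). [cite: Gannon2014, Thm. 3.4(b)] -/
theorem normalizedDeriv_basisDet (hb : IsLevelBasis Γ wt F) (τ : ℍ) :
    D (basisDet Γ wt F) τ = (totalWeight Γ wt : ℂ) * 12⁻¹ * E2 τ * basisDet Γ wt F τ := by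
  obtain ⟨P, hP, hPdiag, hPF⟩ := exists_connection hb
  have hD := congrFun (normalizedDeriv_det (basisMatrix Γ wt F) (mdifferentiable_basisMatrix hb)) τ
  change D (basisDet Γ wt F) τ = _ at hD
  rw [hD]
  have hcol : ∀ j, ((basisMatrix Γ wt F τ).updateCol j fun a ↦ D (fun τ ↦ basisMatrix Γ wt F τ a j) τ).det =
      (P j j τ + (wt j : ℂ) * 12⁻¹ * E2 τ) * (basisMatrix Γ wt F τ).det := by
    intro j
    have := Matrix.det_updateCol_sum (basisMatrix Γ wt F τ) j
      (fun l ↦ P l j τ + if l = j then (wt j : ℂ) * 12⁻¹ * E2 τ else 0)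
    have hfun : (fun a ↦ D (fun τ ↦ basisMatrix Γ wt F τ a j) τ) =
        fun k ↦ ∑ x, (P x j τ + if x = j then (wt j : ℂ) * 12⁻¹ * E2 τ else 0) • basisMatrix Γ wt F τ k x := by
      funext a
      rw [normalizedDeriv_basisMatrix hb hP hPF a j τ]
      simp only [smul_eq_mul, add_mul, Finset.sum_add_distrib, ite_mul, zero_mul, Finset.sum_ite_eq',
        Finset.mem_univ, if_true]
    rw [hfun, this, smul_eq_mul]
    simp
  simp only [hcol, hPdiag, Pi.zero_apply, zero_add, ← Finset.sum_mul]
  rw [basisDet, totalWeight]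
  push_cast
  simp only [Finset.sum_mul]

/-- **`𝒟¹² = c · Δ^K` on `ℍ`** (`K = ∑ k_j ≥ 0`): both sides solve `D y = K E₂ y`
(`D Δ = E₂ Δ`, Ramanujan), so their ratio has zero derivative on the connected `ℍ`.
[cite: Gannon2014, Thm. 3.4(b)] -/
theorem exists_basisDet_pow_eq (hb : IsLevelBasis Γ wt F) (hK : 0 ≤ totalWeight Γ wt) :
    ∃ c : ℂ, ∀ τ, basisDet Γ wt F τ ^ 12 = c * ModularForm.discriminant τ ^ (totalWeight Γ wt).toNat := by
  set K := (totalWeight Γ wt).toNat with hKdef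
  have hKc : ((totalWeight Γ wt : ℤ) : ℂ) = (K : ℂ) := by
    rw [hKdef, show ((totalWeight Γ wt).toNat : ℂ) = (((totalWeight Γ wt).toNat : ℤ) : ℂ) by norm_cast,
      Int.toNat_of_nonneg hK]
  set G : ℍ → ℂ := basisDet Γ wt F ^ 12 with hG
  set H : ℍ → ℂ := ModularForm.discriminant ^ K with hH
  have hGhol : MDiff G := (mdifferentiable_basisDet hb).pow 12
  have hΔhol : MDiff ModularForm.discriminant := CuspForm.discriminant.holo'
  have hHhol : MDiff H := hΔhol.pow K
  have hDG : ∀ τ, D G τ = (K : ℂ) * E2 τ * G τ := by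
    intro τ
    rw [hG, normalizedDerivOfComplex_pow _ _ (mdifferentiable_basisDet hb)]
    simp only [Pi.mul_apply, Pi.pow_apply, Pi.natCast_def]
    rw [normalizedDeriv_basisDet hb τ, hKc]
    have : basisDet Γ wt F τ ^ 12 = basisDet Γ wt F τ ^ (12 - 1) * basisDet Γ wt F τ := by
      rw [← pow_succ]
    rw [this]
    push_cast
    ring
  have hDH : ∀ τ, D H τ = (K : ℂ) * E2 τ * H τ := by
    intro τ
    rw [hH, normalizedDerivOfComplex_pow _ _ hΔhol]
    simp only [Pi.mul_apply, Pi.pow_apply, Pi.natCast_def]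
    rw [normalizedDeriv_discriminant τ]
    rcases Nat.eq_zero_or_pos K with hK0 | hKpos
    · simp [hK0]
    · have : ModularForm.discriminant τ ^ K = ModularForm.discriminant τ ^ (K - 1) * ModularForm.discriminant τ := by
        rw [← pow_succ, Nat.sub_add_cancel hKpos]
      rw [this]
      ring
  have hH0 : ∀ τ, H τ ≠ 0 := fun τ ↦ pow_ne_zero _ (discriminant_ne_zero τ)
  -- the ratio has zero derivative on the upper half-plane
  let R : ℂ → ℂ := fun z ↦ (G ∘ ofComplex) z / (H ∘ ofComplex) z
  have hRderiv : ∀ z : ℂ, 0 < z.im → HasDerivAt R 0 z := by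
    intro z hz
    have hGz := (UpperHalfPlane.mdifferentiableAt_iff.mp (hGhol ⟨z, hz⟩)).hasDerivAt
    have hHz := (UpperHalfPlane.mdifferentiableAt_iff.mp (hHhol ⟨z, hz⟩)).hasDerivAt
    have hH0z : (H ∘ ofComplex) z ≠ 0 := by
      simp only [Function.comp_apply, ofComplex_apply_of_im_pos hz]
      exact hH0 _
    refine (hGz.div hHz hH0z).congr_deriv ?_
    -- numerator vanishes: `G' H - G H' = 2πi (D G · H - G · D H) = 0`
    have eG : deriv (G ∘ ofComplex) z = 2 * π * I * D G ⟨z, hz⟩ := by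
      have : D G ⟨z, hz⟩ = (2 * π * I)⁻¹ * deriv (G ∘ ofComplex) z := rfl
      rw [this, ← mul_assoc, mul_inv_cancel₀ Complex.two_pi_I_ne_zero, one_mul]
    have eH : deriv (H ∘ ofComplex) z = 2 * π * I * D H ⟨z, hz⟩ := by
      have : D H ⟨z, hz⟩ = (2 * π * I)⁻¹ * deriv (H ∘ ofComplex) z := rfl
      rw [this, ← mul_assoc, mul_inv_cancel₀ Complex.two_pi_I_ne_zero, one_mul]
    have hdG : deriv (G ∘ ofComplex) (⟨z, hz⟩ : ℍ) = deriv (G ∘ ofComplex) z := rfl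
    have hdH : deriv (H ∘ ofComplex) (⟨z, hz⟩ : ℍ) = deriv (H ∘ ofComplex) z := rfl
    rw [hdG, hdH, eG, eH, hDG, hDH]
    simp only [Function.comp_apply, ofComplex_apply_of_im_pos hz]
    ring
  have hRconst : ∀ z w : ℂ, 0 < z.im → 0 < w.im → R z = R w := by
    intro z w hz hw
    have hdiff : DifferentiableOn ℂ R {z : ℂ | 0 < z.im} := fun z hz ↦
      (hRderiv z hz).differentiableAt.differentiableWithinAt
    refine (convex_halfSpace_im_gt 0).is_const_of_fderivWithin_eq_zero hdiff ?_ hz hw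
    intro u hu
    rw [fderivWithin_of_isOpen isOpen_upperHalfPlaneSet hu, (hRderiv u hu).hasFDerivAt.fderiv]
    ext
    simp
  refine ⟨R (UpperHalfPlane.I : ℂ), fun τ ↦ ?_⟩
  have := hRconst τ UpperHalfPlane.I τ.im_pos UpperHalfPlane.I.im_pos
  have hRτ : R τ = G τ / H τ := by
    simp only [R, Function.comp_apply, ofComplex_apply]
  rw [← this, hRτ, show ModularForm.discriminant τ ^ K = H τ from rfl, div_mul_cancel₀ _ (hH0 τ)]
  rfl

/-- **`𝒟 ≢ 0`** from a rank input: at a point `τ` where the conjugate matrix of the rank-input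
forms `G_i` is invertible, it factors as `Φ(τ) · Q(τ)` through the basis, so `det Φ(τ) ≠ 0`.
[folklore] -/
theorem exists_basisDet_ne_zero (hb : IsLevelBasis Γ wt F) (R : RankInput Γ) :
    ∃ τ, basisDet Γ wt F τ ≠ 0 := by
  classical
  obtain ⟨τ, hτ⟩ := R.det_ne_zero
  refine ⟨τ, fun hD ↦ hτ ?_⟩
  -- the rank-input forms in the basis
  have hspan := fun i : Fin Γ.index ↦ hb.span R.wt₀ _ (R.mem i)
  choose Q hQ hQsum using hspan
  set e := cosetEquiv Γ
  have hΨ : ∀ a i : Fin Γ.index, cosetSlash Γ R.wt₀ (R.G i) (e.symm a) τ =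
      ∑ j, basisMatrix Γ wt F τ a j * Q i j τ := by
    intro a i
    unfold cosetSlash
    rw [hQsum i, sum_mul_slash_of_levelOne _ (fun j _ ↦ hQ i j), Finset.sum_apply]
    refine Finset.sum_congr rfl fun j _ ↦ ?_
    rw [Pi.mul_apply, mul_comm]
    rfl
  have hdet : (Matrix.of fun a i : Fin Γ.index ↦ cosetSlash Γ R.wt₀ (R.G i) (e.symm a) τ).det =
      (basisMatrix Γ wt F τ).det * (Matrix.of fun j i : Fin Γ.index ↦ Q i j τ).det := by
    rw [← Matrix.det_mul]
    congr 1
    ext a i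
    simp only [Matrix.of_apply, Matrix.mul_apply, hΨ]
  have : (basisMatrix Γ wt F τ).det = 0 := hD
  rw [hdet, this, zero_mul]

/-- **`𝒟¹² = cΔ^K` with `c ≠ 0`; hence `𝒟` has no zero on `ℍ`** (the substitute for the valence
formula in this route). [cite: Gannon2014, Thm. 3.4(b)] -/
theorem exists_basisDet_pow_eq_ne_zero (hb : IsLevelBasis Γ wt F) (R : RankInput Γ) (hK : 0 ≤ totalWeight Γ wt) :
    ∃ c : ℂ, c ≠ 0 ∧ ∀ τ, basisDet Γ wt F τ ^ 12 = c * ModularForm.discriminant τ ^ (totalWeight Γ wt).toNat := by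
  obtain ⟨c, hc⟩ := exists_basisDet_pow_eq hb hK
  obtain ⟨τ, hτ⟩ := exists_basisDet_ne_zero hb R
  refine ⟨c, fun h0 ↦ ?_, hc⟩
  have := hc τ
  rw [h0, zero_mul] at this
  exact pow_ne_zero 12 hτ this

/-- `𝒟(τ) ≠ 0` for every `τ ∈ ℍ`. [cite: Gannon2014, Thm. 3.4(b)] -/
theorem basisDet_ne_zero (hb : IsLevelBasis Γ wt F) (R : RankInput Γ) (hK : 0 ≤ totalWeight Γ wt) (τ : ℍ) :
    basisDet Γ wt F τ ≠ 0 := by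
  obtain ⟨c, hc, h⟩ := exists_basisDet_pow_eq_ne_zero hb R hK
  intro h0
  have := h τ
  rw [h0, zero_pow (by norm_num)] at this
  exact mul_ne_zero hc (pow_ne_zero _ (discriminant_ne_zero τ)) this.symm

/-- **Decay of `𝒟` at `i∞`**: `‖𝒟(τ)‖¹² e^{2πK Im τ} → ‖c‖ ≠ 0`. [folklore] -/
theorem tendsto_norm_basisDet_pow (hb : IsLevelBasis Γ wt F) (R : RankInput Γ) (hK : 0 ≤ totalWeight Γ wt) :
    ∃ C : ℝ, 0 < C ∧ Tendsto (fun τ : ℍ ↦ ‖basisDet Γ wt F τ‖ ^ 12 *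
      Real.exp (2 * π * ((totalWeight Γ wt).toNat * τ.im))) atImInfty (𝓝 C) := by
  obtain ⟨c, hc, h⟩ := exists_basisDet_pow_eq_ne_zero hb R hK
  refine ⟨‖c‖, norm_pos_iff.mpr hc, ?_⟩
  have hΔ := tendsto_norm_discriminant_mul_exp.pow (totalWeight Γ wt).toNat
  rw [one_pow] at hΔ
  have := hΔ.const_mul ‖c‖
  rw [mul_one] at this
  refine this.congr fun τ ↦ ?_
  rw [mul_pow, ← Real.exp_nat_mul, ← norm_pow, ← mul_assoc, ← norm_mul, ← h τ, norm_pow]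
  congr 2
  ring

end Determinant

/-! ### The elliptic-point counts of a level and the generator weights modulo `4` and `6` -/

section EllipticCounts

variable (Γ : Subgroup SL(2, ℤ))

/-- `ν₂(Γ)`: the number of cosets of `SL₂(ℤ)/Γ` fixed by `S` (for `-1 ∈ Γ`, the number of
elliptic points of period `2` of `Γ∖ℍ`, `ModularCurveEllipticPointsProofs`). [folklore] -/
def nu₂Level : ℕ := Nat.card {q : SL(2, ℤ) ⧸ Γ // ModularGroup.S • q = q}

/-- `ν₃(Γ)`: the number of cosets of `SL₂(ℤ)/Γ` fixed by `ST` (for `-1 ∈ Γ`, the number of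
elliptic points of period `3`). [folklore] -/
def nu₃Level : ℕ := Nat.card {q : SL(2, ℤ) ⧸ Γ // (ModularGroup.S * ModularGroup.T) • q = q}

end EllipticCounts

section Elliptic

variable (Γ : Subgroup SL(2, ℤ)) [Γ.FiniteIndex]

/-- The finite coset space `SL₂(ℤ)/Γ` as a `Fintype` (local, from `Finite`). [folklore] -/
local instance : Fintype (SL(2, ℤ) ⧸ Γ) := Fintype.ofFinite _

/-- The permutation of `Fin μ ≃ SL₂(ℤ)/Γ` induced by `q ↦ h⁻¹ q`. [folklore] -/
def cosetPermFin (h : SL(2, ℤ)) : Equiv.Perm (Fin (Γ.index)) :=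
  (cosetEquiv Γ).symm.trans ((MulAction.toPerm h⁻¹).trans (cosetEquiv Γ))

/-- Formula for `cosetPermFin`. [folklore] -/
theorem cosetPermFin_apply (h : SL(2, ℤ)) (a : Fin (Γ.index)) :
    cosetPermFin Γ h a = cosetEquiv Γ (h⁻¹ • (cosetEquiv Γ).symm a) := rfl

/-- Powers of `cosetPermFin`. [folklore] -/
theorem cosetPermFin_pow_apply (h : SL(2, ℤ)) (n : ℕ) (a : Fin (Γ.index)) :
    (cosetPermFin Γ h ^ n) a = cosetEquiv Γ ((h⁻¹) ^ n • (cosetEquiv Γ).symm a) := by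
  induction n generalizing a with
  | zero => simp
  | succ n ih =>
    rw [pow_succ, Equiv.Perm.mul_apply, cosetPermFin_apply, ih, Equiv.symm_apply_apply, smul_smul, ← pow_succ]

/-- If `hᵖ = -1` then `cosetPermFin h` has order dividing `p`. [folklore] -/
theorem cosetPermFin_pow_eq_one (hneg : -1 ∈ Γ) {h : SL(2, ℤ)} {p : ℕ} (hh : h ^ p = -1) :
    cosetPermFin Γ h ^ p = 1 := by
  ext a
  rw [cosetPermFin_pow_apply, inv_pow, hh, show (-1 : SL(2, ℤ))⁻¹ = -1 by simp, neg_one_smul_coset hneg,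
    Equiv.apply_symm_apply, Equiv.Perm.one_apply]

/-- Fixed points of `cosetPermFin h` correspond to cosets fixed by `h`. [folklore] -/
theorem card_fixed_cosetPermFin (h : SL(2, ℤ)) :
    (Finset.univ.filter fun a ↦ cosetPermFin Γ h a = a).card =
      Nat.card {q : SL(2, ℤ) ⧸ Γ // h • q = q} := by
  classical
  rw [Nat.card_eq_fintype_card, Fintype.card_subtype]
  refine Finset.card_bij (fun a _ ↦ (cosetEquiv Γ).symm a) (fun a ha ↦ ?_)
    (fun a _ b _ hab ↦ (cosetEquiv Γ).symm.injective hab) (fun q hq ↦ ⟨cosetEquiv Γ q, ?_, by simp⟩)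
  · rw [Finset.mem_filter] at ha ⊢
    refine ⟨Finset.mem_univ _, ?_⟩
    have := congrArg (cosetEquiv Γ).symm ha.2
    rw [cosetPermFin_apply, Equiv.symm_apply_apply, inv_smul_eq_iff] at this
    exact this.symm
  · rw [Finset.mem_filter] at hq ⊢
    refine ⟨Finset.mem_univ _, ?_⟩
    rw [cosetPermFin_apply, Equiv.symm_apply_apply]
    congr 1
    rw [inv_smul_eq_iff, hq.2]

variable {Γ} {wt : Fin (Γ.index) → ℤ} {F : Fin (Γ.index) → ℍ → ℂ}

/-- **The eigen-relation at a fixed point**: if `h z₀ = z₀` then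
`Φ(z₀)_{h⁻¹a, j} = j(h, z₀)^{-k_j} Φ(z₀)_{a,j}` (covariance of `Φ`). [folklore] -/
theorem basisMatrix_cosetPermFin (hb : IsLevelBasis Γ wt F) {h : SL(2, ℤ)} {z₀ : ℍ} (hz : h • z₀ = z₀)
    (a j : Fin (Γ.index)) :
    basisMatrix Γ wt F z₀ (cosetPermFin Γ h a) j = denom h z₀ ^ (-wt j) * basisMatrix Γ wt F z₀ a j := by
  have hF := slash_eq_of_mem_levelSpace (hb.mem j)
  unfold basisMatrix
  rw [cosetPermFin_apply, Equiv.symm_apply_apply, ← cosetSlash_slash hF, ← ModularForm.SL_slash,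
    ModularForm.SL_slash_apply, hz, mul_comm]

/-- The columns of `Φ(τ)` are linearly independent (`𝒟(τ) ≠ 0`). [folklore] -/
theorem linearIndependent_basisMatrix_col (hb : IsLevelBasis Γ wt F) (R : RankInput Γ) (hK : 0 ≤ totalWeight Γ wt) (τ : ℍ) :
    LinearIndependent ℂ (fun j a ↦ basisMatrix Γ wt F τ a j) := by
  have : IsUnit (basisMatrix Γ wt F τ) :=
    (Matrix.isUnit_iff_isUnit_det _).mpr (isUnit_iff_ne_zero.mpr (basisDet_ne_zero hb R hK τ))
  exact Matrix.linearIndependent_cols_iff_isUnit.mpr this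

omit [Γ.FiniteIndex] in
/-- `0 ≤ K` when all weights are `≥ 0`. [folklore] -/
theorem totalWeight_nonneg (hwt : ∀ j, 0 ≤ wt j ∧ Even (wt j)) : 0 ≤ totalWeight Γ wt :=
  Finset.sum_nonneg fun j _ ↦ (hwt j).1

/-- The common core of the two counts: the eigen-count inequalities for `h` with `hᵖ = -1` fixing
`z₀`, applied to the columns of `Φ(z₀)`. [folklore] -/
theorem eigenCount_basisMatrix (hb : IsLevelBasis Γ wt F) (R : RankInput Γ) (hneg : -1 ∈ Γ)
    (hwt : ∀ j, 0 ≤ wt j ∧ Even (wt j))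
    {h : SL(2, ℤ)} {p : ℕ} (hp : p.Prime) (hh : h ^ p = -1) {z₀ : ℍ} (hz : h • z₀ = z₀) :
    (∀ c : ℂ, c ≠ 1 → p * (Finset.univ.filter fun j ↦ denom h z₀ ^ (-wt j) = c).card +
        Nat.card {q : SL(2, ℤ) ⧸ Γ // h • q = q} ≤ Γ.index) ∧
    p * (Finset.univ.filter fun j ↦ denom h z₀ ^ (-wt j) = 1).card ≤
      Γ.index + (p - 1) * Nat.card {q : SL(2, ℤ) ⧸ Γ // h • q = q} := by
  classical
  have := eigenCount_le hp (cosetPermFin Γ h) (cosetPermFin_pow_eq_one Γ hneg hh)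
    (fun j a ↦ basisMatrix Γ wt F z₀ a j) (linearIndependent_basisMatrix_col hb R (totalWeight_nonneg hwt) z₀)
    (fun j ↦ denom h z₀ ^ (-wt j)) (fun j a ↦ basisMatrix_cosetPermFin hb hz a j)
  rwa [card_fixed_cosetPermFin] at this

/-- **Weights modulo `4`**: `2 · #{j : 4 ∣ k_j} = μ + ν₂` and `2 · #{j : 4 ∤ k_j} + ν₂ = μ`
(the columns of `Φ(i)` are `±1`-eigenvectors of the coset permutation of `S`, with eigenvalue
`i^{-k_j} = 1` iff `4 ∣ k_j`; `S` has `ν₂` fixed cosets). [cite: Gannon2014, Thm. 3.4(b)] -/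
theorem two_mul_card_four_dvd (hb : IsLevelBasis Γ wt F) (R : RankInput Γ) (hneg : -1 ∈ Γ)
    (hwt : ∀ j, 0 ≤ wt j ∧ Even (wt j)) :
    2 * (Finset.univ.filter fun j ↦ (4 : ℤ) ∣ wt j).card = Γ.index + nu₂Level Γ ∧
    2 * (Finset.univ.filter fun j ↦ ¬ (4 : ℤ) ∣ wt j).card + nu₂Level Γ = Γ.index := by
  classical
  obtain ⟨hne, h1⟩ := eigenCount_basisMatrix hb R hneg hwt Nat.prime_two S_sq_eq S_smul_I
  rw [← nu₂Level] at hne h1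
  have hden : denom ModularGroup.S UpperHalfPlane.I = Complex.I := by
    rw [ModularGroup.denom_S]; rfl
  simp only [hden] at hne h1
  -- identify the classes
  have hcls : ∀ j, (Complex.I ^ (-wt j) = 1 ↔ (4 : ℤ) ∣ wt j) ∧ (Complex.I ^ (-wt j) = -1 ↔ ¬ (4 : ℤ) ∣ wt j) := by
    intro j
    obtain ⟨n, hn⟩ := exists_eq_two_mul (hwt j).1 (hwt j).2
    rw [hn, I_zpow_neg_two_mul]
    have h4 : (4 : ℤ) ∣ 2 * (n : ℤ) ↔ Even n := by
      constructor
      · rintro ⟨k, hk⟩; exact ⟨k.toNat, by omega⟩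
      · rintro ⟨k, hk⟩; exact ⟨k, by omega⟩
    rw [h4]
    have h11 : (1 : ℂ) ≠ -1 := by norm_num
    have h11' : (-1 : ℂ) ≠ 1 := by norm_num
    rcases Nat.even_or_odd n with he | ho
    · simp [he.neg_one_pow, he, h11]
    · simp [ho.neg_one_pow, Nat.not_even_iff_odd.mpr ho, h11']
  have e1 : (Finset.univ.filter fun j ↦ Complex.I ^ (-wt j) = 1) = Finset.univ.filter fun j ↦ (4 : ℤ) ∣ wt j :=
    Finset.filter_congr fun j _ ↦ (hcls j).1
  have e2 : (Finset.univ.filter fun j ↦ Complex.I ^ (-wt j) = -1) = Finset.univ.filter fun j ↦ ¬ (4 : ℤ) ∣ wt j :=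
    Finset.filter_congr fun j _ ↦ (hcls j).2
  have hsum : (Finset.univ.filter fun j ↦ (4 : ℤ) ∣ wt j).card +
      (Finset.univ.filter fun j ↦ ¬ (4 : ℤ) ∣ wt j).card = Γ.index := by
    rw [Finset.card_filter_add_card_filter_not, Finset.card_univ, Fintype.card_fin]
  have hA := hne (-1) (by norm_num)
  rw [e2] at hA
  rw [e1] at h1
  omega

/-- **Weights modulo `6`**: `3 · #{j : 6 ∣ k_j} = μ + 2ν₃`, `3 · #{j : k_j ≡ 2 (6)} + ν₃ = μ`,
`3 · #{j : k_j ≡ 4 (6)} + ν₃ = μ` (eigenvectors of the coset permutation of `ST`, `(ST)³ = -1`,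
fixed point `ρ`, eigenvalues `(ρ+1)^{-k_j} ∈ {1, ρ², ρ}`; `ν₃` fixed cosets). [cite: Gannon2014, Thm. 3.4(b)] -/
theorem three_mul_card_six_dvd (hb : IsLevelBasis Γ wt F) (R : RankInput Γ) (hneg : -1 ∈ Γ)
    (hwt : ∀ j, 0 ≤ wt j ∧ Even (wt j)) :
    3 * (Finset.univ.filter fun j ↦ (6 : ℤ) ∣ wt j).card = Γ.index + 2 * nu₃Level Γ ∧
    3 * (Finset.univ.filter fun j ↦ wt j % 6 = 2).card + nu₃Level Γ = Γ.index ∧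
    3 * (Finset.univ.filter fun j ↦ wt j % 6 = 4).card + nu₃Level Γ = Γ.index := by
  classical
  obtain ⟨hne, h1⟩ := eigenCount_basisMatrix hb R hneg hwt Nat.prime_three ST_pow_three_eq ST_smul_rho
  rw [← nu₃Level, denom_ST_rho] at hne h1
  set ρ' : ℂ := (UpperHalfPlane.ρ : ℂ) with hρ'
  have hρ3 : ρ' ^ 3 = 1 := rho_pow_three
  obtain ⟨hρ1, hρ2⟩ := rho_ne_one
  -- identify the classes
  have hcls : ∀ j, ((ρ' + 1) ^ (-wt j) = 1 ↔ (6 : ℤ) ∣ wt j) ∧ ((ρ' + 1) ^ (-wt j) = ρ' ^ 2 ↔ wt j % 6 = 2) ∧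
      ((ρ' + 1) ^ (-wt j) = ρ' ↔ wt j % 6 = 4) := by
    intro j
    obtain ⟨n, hn⟩ := exists_eq_two_mul (hwt j).1 (hwt j).2
    rw [hn, rho_add_one_zpow_neg_two_mul]
    have hpow : ρ' ^ n = ρ' ^ (n % 3) := by
      conv_lhs => rw [← Nat.div_add_mod n 3, pow_add, pow_mul, hρ3, one_pow, one_mul]
    rw [hpow]
    have h6 : ((6 : ℤ) ∣ 2 * (n : ℤ) ↔ n % 3 = 0) ∧ (2 * (n : ℤ) % 6 = 2 ↔ n % 3 = 1) ∧
        (2 * (n : ℤ) % 6 = 4 ↔ n % 3 = 2) := by omega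
    rw [h6.1, h6.2.1, h6.2.2]
    have hρ0 : ρ' ≠ 0 := fun h ↦ by rw [h] at hρ3; norm_num at hρ3
    have hinv1 : ρ'⁻¹ = ρ' ^ 2 := inv_eq_of_mul_eq_one_right (by rw [← pow_succ', hρ3])
    have hinv2 : (ρ' ^ 2)⁻¹ = ρ' := inv_eq_of_mul_eq_one_right (by rw [← pow_succ, hρ3])
    have hne21 : ρ' ^ 2 ≠ ρ' := fun h ↦ hρ1 (by
      have : ρ' * ρ' = ρ' * 1 := by rw [mul_one, ← pow_two, h]
      exact mul_left_cancel₀ hρ0 this)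
    obtain ⟨r, hr, hr3⟩ : ∃ r, n % 3 = r ∧ r < 3 := ⟨n % 3, rfl, Nat.mod_lt _ (by norm_num)⟩
    rw [hr]
    interval_cases r <;> simp only [pow_zero, inv_one, pow_one, hinv1, hinv2]
    · exact ⟨by simp, iff_of_false (fun h ↦ hρ2 h.symm) (by norm_num),
        iff_of_false (fun h ↦ hρ1 h.symm) (by norm_num)⟩
    · exact ⟨iff_of_false hρ2 (by norm_num), by simp, iff_of_false hne21 (by norm_num)⟩
    · exact ⟨iff_of_false hρ1 (by norm_num), iff_of_false (Ne.symm hne21) (by norm_num), by simp⟩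
  have e0 : (Finset.univ.filter fun j ↦ (ρ' + 1) ^ (-wt j) = 1) = Finset.univ.filter fun j ↦ (6 : ℤ) ∣ wt j :=
    Finset.filter_congr fun j _ ↦ (hcls j).1
  have e2 : (Finset.univ.filter fun j ↦ (ρ' + 1) ^ (-wt j) = ρ' ^ 2) = Finset.univ.filter fun j ↦ wt j % 6 = 2 :=
    Finset.filter_congr fun j _ ↦ (hcls j).2.1
  have e4 : (Finset.univ.filter fun j ↦ (ρ' + 1) ^ (-wt j) = ρ') = Finset.univ.filter fun j ↦ wt j % 6 = 4 :=
    Finset.filter_congr fun j _ ↦ (hcls j).2.2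
  -- the three classes partition the generators
  have hsum : (Finset.univ.filter fun j ↦ (6 : ℤ) ∣ wt j).card + (Finset.univ.filter fun j ↦ wt j % 6 = 2).card +
      (Finset.univ.filter fun j ↦ wt j % 6 = 4).card = Γ.index := by
    have htri : ∀ j, ((6 : ℤ) ∣ wt j ∨ wt j % 6 = 2 ∨ wt j % 6 = 4) ∧
        ¬ ((6 : ℤ) ∣ wt j ∧ wt j % 6 = 2) ∧ ¬ ((6 : ℤ) ∣ wt j ∧ wt j % 6 = 4) ∧ ¬ (wt j % 6 = 2 ∧ wt j % 6 = 4) := by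
      intro j
      obtain ⟨n, hn⟩ := exists_eq_two_mul (hwt j).1 (hwt j).2
      omega
    rw [← Finset.card_union_of_disjoint (Finset.disjoint_filter.mpr fun j _ h h' ↦ (htri j).2.1 ⟨h, h'⟩),
      ← Finset.filter_or, ← Finset.card_union_of_disjoint (Finset.disjoint_filter.mpr fun j _ h h' ↦ by
        rcases h with h | h
        · exact (htri j).2.2.1 ⟨h, h'⟩
        · exact (htri j).2.2.2 ⟨h, h'⟩), ← Finset.filter_or]
    rw [Finset.filter_true_of_mem (fun j _ ↦ by have := (htri j).1; tauto), Finset.card_univ,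
      Fintype.card_fin]
  have hA := hne (ρ' ^ 2) hρ2
  have hB := hne ρ' hρ1
  rw [e2] at hA
  rw [e4] at hB
  rw [e0] at h1
  omega

end Elliptic

end Level

end Literature.NumberTheory.EllipticCurves.ModularForms
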